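import Mathlib
import Summits.Ventures.PercRepro2.Tail2DBlockCalc
import Summits.Ventures.PercRepro2.Tail2DHarrisSP
import Summits.Ventures.PercRepro2.Tail2DFlowOneBlocks
import Summits.Ventures.PercRepro2.Tail2DFlowOneThreeCounts

/-!
# Three flow-one networks in parallel: the certificate at `(2,0)` — blocks, counts, source coverage
(seat mine-b, cell pub-perc-repro2; conjectures/MINE-B.md §43)

The position `(2,0)` of (SD) on `Z = (s ∥ t) ∥ r` (three flow-one factors `s, t, r` with red crossings) is the first
with a genuine mixture.  Write `a_i = #R_i = #B_i`, `c_i = #C_i`, `A = a₁a₂a₃`, `|E| = #E(2,0)`, `|E'| = #E(1,1)`.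
The 21 product-block moves (`cert20A/A'/B/B'`, weights `cert20W`): the word `RRR` goes to `(B_i, col_l, R_j)` for
the six ordered pairs `i ≠ l` (one red flipped, one red RELAXED to `col = C ⊔ B`) with mass `#target · A/(|E||E'|)`;
each `RRB_j` stays with mass `A/|E'|` and flips one of its reds with mass `A(1/|E| − 1/|E'|)/2`; each `RRC_l`
flips one of its reds with mass `a_i a_j c_l/(2|E|)`.  The relaxed red pays the T-class mismatch of the three-letter
words (the target has relatively more mass on words with a `C`); the excess `1/|E| − 1/|E'| ≥ 0` is the count
inequality `|E| ≤ |E'|`, and the coverage identities use only `|E| = a₁a₂n₃ + a₁m₂a₃ + m₁a₂a₃` and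
`|E'| = n₁n₂n₃ + c₁c₂c₃ − 2m₁m₂m₃` (`m = a + c`, `n = 2a + c`).  The six coverage lemmas `cov20_*` split the 27
letter cases by the first factor: the source side here, the target side and the assembly `cert3_20` in
`Tail2DFlowOneThreeTwentyB.lean`.
-/

namespace Summit.Ventures.PercRepro2.Tail2D

open V2Closure Finset

section Twenty

variable (s t r : V2Closure.SP)

/-- the source blocks of the first two factors in the `(2,0)` certificate -/
def cert20A : Fin 21 → Finset (V2Closure.SP.par s t).Conf :=
  ![(rSet s ×ˢ rSet t : Finset (V2Closure.SP.par s t).Conf), (rSet s ×ˢ rSet t : Finset (V2Closure.SP.par s t).Conf),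
    (rSet s ×ˢ rSet t : Finset (V2Closure.SP.par s t).Conf), (rSet s ×ˢ rSet t : Finset (V2Closure.SP.par s t).Conf),
    (rSet s ×ˢ rSet t : Finset (V2Closure.SP.par s t).Conf), (rSet s ×ˢ rSet t : Finset (V2Closure.SP.par s t).Conf),
    (bSet s ×ˢ rSet t : Finset (V2Closure.SP.par s t).Conf), (rSet s ×ˢ bSet t : Finset (V2Closure.SP.par s t).Conf),
    (rSet s ×ˢ rSet t : Finset (V2Closure.SP.par s t).Conf), (bSet s ×ˢ rSet t : Finset (V2Closure.SP.par s t).Conf),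
    (bSet s ×ˢ rSet t : Finset (V2Closure.SP.par s t).Conf), (rSet s ×ˢ bSet t : Finset (V2Closure.SP.par s t).Conf),
    (rSet s ×ˢ bSet t : Finset (V2Closure.SP.par s t).Conf), (rSet s ×ˢ rSet t : Finset (V2Closure.SP.par s t).Conf),
    (rSet s ×ˢ rSet t : Finset (V2Closure.SP.par s t).Conf), (cellSet s ×ˢ rSet t : Finset (V2Closure.SP.par s t).Conf),
    (cellSet s ×ˢ rSet t : Finset (V2Closure.SP.par s t).Conf), (rSet s ×ˢ cellSet t : Finset (V2Closure.SP.par s t).Conf),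
    (rSet s ×ˢ cellSet t : Finset (V2Closure.SP.par s t).Conf), (rSet s ×ˢ rSet t : Finset (V2Closure.SP.par s t).Conf),
    (rSet s ×ˢ rSet t : Finset (V2Closure.SP.par s t).Conf)]

/-- the target blocks of the first two factors in the `(2,0)` certificate -/
def cert20A' : Fin 21 → Finset (V2Closure.SP.par s t).Conf :=
  ![(bSet s ×ˢ colSet t : Finset (V2Closure.SP.par s t).Conf), (bSet s ×ˢ rSet t : Finset (V2Closure.SP.par s t).Conf),
    (colSet s ×ˢ bSet t : Finset (V2Closure.SP.par s t).Conf), (rSet s ×ˢ bSet t : Finset (V2Closure.SP.par s t).Conf),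
    (colSet s ×ˢ rSet t : Finset (V2Closure.SP.par s t).Conf), (rSet s ×ˢ colSet t : Finset (V2Closure.SP.par s t).Conf),
    (bSet s ×ˢ rSet t : Finset (V2Closure.SP.par s t).Conf), (rSet s ×ˢ bSet t : Finset (V2Closure.SP.par s t).Conf),
    (rSet s ×ˢ rSet t : Finset (V2Closure.SP.par s t).Conf), (bSet s ×ˢ bSet t : Finset (V2Closure.SP.par s t).Conf),
    (bSet s ×ˢ rSet t : Finset (V2Closure.SP.par s t).Conf), (bSet s ×ˢ bSet t : Finset (V2Closure.SP.par s t).Conf),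
    (rSet s ×ˢ bSet t : Finset (V2Closure.SP.par s t).Conf), (bSet s ×ˢ rSet t : Finset (V2Closure.SP.par s t).Conf),
    (rSet s ×ˢ bSet t : Finset (V2Closure.SP.par s t).Conf), (cellSet s ×ˢ bSet t : Finset (V2Closure.SP.par s t).Conf),
    (cellSet s ×ˢ rSet t : Finset (V2Closure.SP.par s t).Conf), (bSet s ×ˢ cellSet t : Finset (V2Closure.SP.par s t).Conf),
    (rSet s ×ˢ cellSet t : Finset (V2Closure.SP.par s t).Conf), (bSet s ×ˢ rSet t : Finset (V2Closure.SP.par s t).Conf),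
    (rSet s ×ˢ bSet t : Finset (V2Closure.SP.par s t).Conf)]

/-- the source blocks of the third factor in the `(2,0)` certificate -/
def cert20B : Fin 21 → Finset r.Conf :=
  ![rSet r, rSet r, rSet r, rSet r, rSet r, rSet r, rSet r,
    rSet r, bSet r, rSet r, rSet r, rSet r, rSet r, bSet r,
    bSet r, rSet r, rSet r, rSet r, rSet r, cellSet r, cellSet r]

/-- the target blocks of the third factor in the `(2,0)` certificate -/
def cert20B' : Fin 21 → Finset r.Conf :=
  ![rSet r, colSet r, rSet r, colSet r, bSet r, bSet r, rSet r,
    rSet r, bSet r, rSet r, bSet r, rSet r, bSet r, bSet r,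
    bSet r, rSet r, bSet r, rSet r, bSet r, cellSet r, cellSet r]

/-- the weights of the `(2,0)` certificate -/
def cert20W : Fin 21 → ℚ :=
  ![((bSet s).card : ℚ) * ((colSet t).card : ℚ) * ((rSet r).card : ℚ) * (((rSet s).card : ℚ) * ((rSet t).card : ℚ) * ((rSet r).card : ℚ)) / ((tailCount (V2Closure.SP.par (V2Closure.SP.par s t) r) 2 0 : ℚ) * (tailCount (V2Closure.SP.par (V2Closure.SP.par s t) r) 1 1 : ℚ)),
    ((bSet s).card : ℚ) * ((rSet t).card : ℚ) * ((colSet r).card : ℚ) * (((rSet s).card : ℚ) * ((rSet t).card : ℚ) * ((rSet r).card : ℚ)) / ((tailCount (V2Closure.SP.par (V2Closure.SP.par s t) r) 2 0 : ℚ) * (tailCount (V2Closure.SP.par (V2Closure.SP.par s t) r) 1 1 : ℚ)),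
    ((colSet s).card : ℚ) * ((bSet t).card : ℚ) * ((rSet r).card : ℚ) * (((rSet s).card : ℚ) * ((rSet t).card : ℚ) * ((rSet r).card : ℚ)) / ((tailCount (V2Closure.SP.par (V2Closure.SP.par s t) r) 2 0 : ℚ) * (tailCount (V2Closure.SP.par (V2Closure.SP.par s t) r) 1 1 : ℚ)),
    ((rSet s).card : ℚ) * ((bSet t).card : ℚ) * ((colSet r).card : ℚ) * (((rSet s).card : ℚ) * ((rSet t).card : ℚ) * ((rSet r).card : ℚ)) / ((tailCount (V2Closure.SP.par (V2Closure.SP.par s t) r) 2 0 : ℚ) * (tailCount (V2Closure.SP.par (V2Closure.SP.par s t) r) 1 1 : ℚ)),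
    ((colSet s).card : ℚ) * ((rSet t).card : ℚ) * ((bSet r).card : ℚ) * (((rSet s).card : ℚ) * ((rSet t).card : ℚ) * ((rSet r).card : ℚ)) / ((tailCount (V2Closure.SP.par (V2Closure.SP.par s t) r) 2 0 : ℚ) * (tailCount (V2Closure.SP.par (V2Closure.SP.par s t) r) 1 1 : ℚ)),
    ((rSet s).card : ℚ) * ((colSet t).card : ℚ) * ((bSet r).card : ℚ) * (((rSet s).card : ℚ) * ((rSet t).card : ℚ) * ((rSet r).card : ℚ)) / ((tailCount (V2Closure.SP.par (V2Closure.SP.par s t) r) 2 0 : ℚ) * (tailCount (V2Closure.SP.par (V2Closure.SP.par s t) r) 1 1 : ℚ)),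
    (((rSet s).card : ℚ) * ((rSet t).card : ℚ) * ((rSet r).card : ℚ)) / (tailCount (V2Closure.SP.par (V2Closure.SP.par s t) r) 1 1 : ℚ),
    (((rSet s).card : ℚ) * ((rSet t).card : ℚ) * ((rSet r).card : ℚ)) / (tailCount (V2Closure.SP.par (V2Closure.SP.par s t) r) 1 1 : ℚ),
    (((rSet s).card : ℚ) * ((rSet t).card : ℚ) * ((rSet r).card : ℚ)) / (tailCount (V2Closure.SP.par (V2Closure.SP.par s t) r) 1 1 : ℚ),
    (((rSet s).card : ℚ) * ((rSet t).card : ℚ) * ((rSet r).card : ℚ)) * (1 / (tailCount (V2Closure.SP.par (V2Closure.SP.par s t) r) 2 0 : ℚ) - 1 / (tailCount (V2Closure.SP.par (V2Closure.SP.par s t) r) 1 1 : ℚ)) / 2,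
    (((rSet s).card : ℚ) * ((rSet t).card : ℚ) * ((rSet r).card : ℚ)) * (1 / (tailCount (V2Closure.SP.par (V2Closure.SP.par s t) r) 2 0 : ℚ) - 1 / (tailCount (V2Closure.SP.par (V2Closure.SP.par s t) r) 1 1 : ℚ)) / 2,
    (((rSet s).card : ℚ) * ((rSet t).card : ℚ) * ((rSet r).card : ℚ)) * (1 / (tailCount (V2Closure.SP.par (V2Closure.SP.par s t) r) 2 0 : ℚ) - 1 / (tailCount (V2Closure.SP.par (V2Closure.SP.par s t) r) 1 1 : ℚ)) / 2,
    (((rSet s).card : ℚ) * ((rSet t).card : ℚ) * ((rSet r).card : ℚ)) * (1 / (tailCount (V2Closure.SP.par (V2Closure.SP.par s t) r) 2 0 : ℚ) - 1 / (tailCount (V2Closure.SP.par (V2Closure.SP.par s t) r) 1 1 : ℚ)) / 2,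
    (((rSet s).card : ℚ) * ((rSet t).card : ℚ) * ((rSet r).card : ℚ)) * (1 / (tailCount (V2Closure.SP.par (V2Closure.SP.par s t) r) 2 0 : ℚ) - 1 / (tailCount (V2Closure.SP.par (V2Closure.SP.par s t) r) 1 1 : ℚ)) / 2,
    (((rSet s).card : ℚ) * ((rSet t).card : ℚ) * ((rSet r).card : ℚ)) * (1 / (tailCount (V2Closure.SP.par (V2Closure.SP.par s t) r) 2 0 : ℚ) - 1 / (tailCount (V2Closure.SP.par (V2Closure.SP.par s t) r) 1 1 : ℚ)) / 2,
    ((cellSet s).card : ℚ) * ((bSet t).card : ℚ) * ((rSet r).card : ℚ) / (2 * (tailCount (V2Closure.SP.par (V2Closure.SP.par s t) r) 2 0 : ℚ)),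
    ((cellSet s).card : ℚ) * ((rSet t).card : ℚ) * ((bSet r).card : ℚ) / (2 * (tailCount (V2Closure.SP.par (V2Closure.SP.par s t) r) 2 0 : ℚ)),
    ((bSet s).card : ℚ) * ((cellSet t).card : ℚ) * ((rSet r).card : ℚ) / (2 * (tailCount (V2Closure.SP.par (V2Closure.SP.par s t) r) 2 0 : ℚ)),
    ((rSet s).card : ℚ) * ((cellSet t).card : ℚ) * ((bSet r).card : ℚ) / (2 * (tailCount (V2Closure.SP.par (V2Closure.SP.par s t) r) 2 0 : ℚ)),
    ((bSet s).card : ℚ) * ((rSet t).card : ℚ) * ((cellSet r).card : ℚ) / (2 * (tailCount (V2Closure.SP.par (V2Closure.SP.par s t) r) 2 0 : ℚ)),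
    ((rSet s).card : ℚ) * ((bSet t).card : ℚ) * ((cellSet r).card : ℚ) / (2 * (tailCount (V2Closure.SP.par (V2Closure.SP.par s t) r) 2 0 : ℚ))]

/-- `#E(2,0)` in `ℚ` -/
theorem count20q (hs : FlowOne s) (ht : FlowOne t) (hr : FlowOne r) :
    (tailCount (V2Closure.SP.par (V2Closure.SP.par s t) r) 2 0 : ℚ)
      = (rSet s).card * (rSet t).card * (2 * (rSet r).card + (cellSet r).card)
        + (rSet s).card * ((rSet t).card + (cellSet t).card) * (rSet r).card
        + ((rSet s).card + (cellSet s).card) * (rSet t).card * (rSet r).card := by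
  rw [tailCount_par3_20 s t r hs ht hr]; push_cast; ring

/-- `#E(1,1)` in `ℚ`: `n₁n₂n₃ + c₁c₂c₃ − 2 m₁m₂m₃` -/
theorem count11q (hs : FlowOne s) (ht : FlowOne t) (hr : FlowOne r) :
    (tailCount (V2Closure.SP.par (V2Closure.SP.par s t) r) 1 1 : ℚ)
      = (2 * (rSet s).card + (cellSet s).card) * (2 * (rSet t).card + (cellSet t).card)
          * (2 * (rSet r).card + (cellSet r).card)
        + (cellSet s).card * (cellSet t).card * (cellSet r).card
        - 2 * (((rSet s).card + (cellSet s).card) * ((rSet t).card + (cellSet t).card)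
          * ((rSet r).card + (cellSet r).card)) := by
  have h := congrArg (fun n : ℕ => (n : ℚ)) (tailCount_par3_11_add s t r hs ht hr)
  push_cast at h
  linarith

/-- `#E(2,0) > 0` -/
theorem count20_pos (hs : FlowOne s) (ht : FlowOne t) (hr : FlowOne r) (ha : 0 < (rSet s).card)
    (ha' : 0 < (rSet t).card) (ha'' : 0 < (rSet r).card) : (0 : ℚ) < tailCount (V2Closure.SP.par (V2Closure.SP.par s t) r) 2 0 := by
  rw [count20q s t r hs ht hr]
  have h1 : (0 : ℚ) < (rSet s).card := by exact_mod_cast ha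
  have h2 : (0 : ℚ) < (rSet t).card := by exact_mod_cast ha'
  have h3 : (0 : ℚ) < (rSet r).card := by exact_mod_cast ha''
  positivity

/-- `#E(1,1) = 6A + 2(a₁a₂c₃ + a₁c₂a₃ + c₁a₂a₃) > 0` -/
theorem count11_pos (hs : FlowOne s) (ht : FlowOne t) (hr : FlowOne r) (ha : 0 < (rSet s).card)
    (ha' : 0 < (rSet t).card) (ha'' : 0 < (rSet r).card) : (0 : ℚ) < tailCount (V2Closure.SP.par (V2Closure.SP.par s t) r) 1 1 := by
  rw [count11q s t r hs ht hr]
  have h1 : (0 : ℚ) < (rSet s).card := by exact_mod_cast ha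
  have h2 : (0 : ℚ) < (rSet t).card := by exact_mod_cast ha'
  have h3 : (0 : ℚ) < (rSet r).card := by exact_mod_cast ha''
  have c1 : (0 : ℚ) ≤ (cellSet s).card := by positivity
  have c2 : (0 : ℚ) ≤ (cellSet t).card := by positivity
  have c3 : (0 : ℚ) ≤ (cellSet r).card := by positivity
  nlinarith [mul_pos (mul_pos h1 h2) h3, mul_nonneg (mul_nonneg h1.le h2.le) c3,
    mul_nonneg (mul_nonneg h1.le c2) h3.le, mul_nonneg (mul_nonneg c1 h2.le) h3.le]

/-- the excess `1/|E| − 1/|E'| ≥ 0`: `|E| ≤ |E'|` -/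
theorem excess20_nonneg (hs : FlowOne s) (ht : FlowOne t) (hr : FlowOne r) (ha : 0 < (rSet s).card)
    (ha' : 0 < (rSet t).card) (ha'' : 0 < (rSet r).card) :
    (0 : ℚ) ≤ 1 / (tailCount (V2Closure.SP.par (V2Closure.SP.par s t) r) 2 0 : ℚ) - 1 / (tailCount (V2Closure.SP.par (V2Closure.SP.par s t) r) 1 1 : ℚ) := by
  rw [sub_nonneg, div_le_div_iff₀ (count11_pos s t r hs ht hr ha ha' ha'') (count20_pos s t r hs ht hr ha ha' ha''),
    one_mul, one_mul, count20q s t r hs ht hr, count11q s t r hs ht hr]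
  have h1 : (0 : ℚ) ≤ (rSet s).card := by positivity
  have h2 : (0 : ℚ) ≤ (rSet t).card := by positivity
  have h3 : (0 : ℚ) ≤ (rSet r).card := by positivity
  have c1 : (0 : ℚ) ≤ (cellSet s).card := by positivity
  have c2 : (0 : ℚ) ≤ (cellSet t).card := by positivity
  have c3 : (0 : ℚ) ≤ (cellSet r).card := by positivity
  nlinarith [mul_nonneg (mul_nonneg h1 h2) h3, mul_nonneg (mul_nonneg h1 h2) c3,
    mul_nonneg (mul_nonneg h1 c2) h3, mul_nonneg (mul_nonneg c1 h2) h3]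

/-- the coverage identity of the `(2,0)` certificate (source side, first factor in `R`) -/
theorem cov20_src_R (hs : FlowOne s) (ht : FlowOne t) (hr : FlowOne r) (ha : 0 < (rSet s).card)
    (ha' : 0 < (rSet t).card) (ha'' : 0 < (rSet r).card) (q : (V2Closure.SP.par s t).Conf) (z : r.Conf)
    (hx : s.rLab q.1 = 1 ∧ s.bLab q.1 = 0) :
    ∑ k : Fin 21, cert20W s t r k * unifDens (V2Closure.SP.par (V2Closure.SP.par s t) r) (cert20A s t k ×ˢ cert20B r k) ((q, z) : (V2Closure.SP.par s t).Conf × r.Conf)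
      = unifDens (V2Closure.SP.par (V2Closure.SP.par s t) r) (tailSet (V2Closure.SP.par (V2Closure.SP.par s t) r) 2 0) ((q, z) : (V2Closure.SP.par s t).Conf × r.Conf) := by
  obtain ⟨hB, hCol, -, -, hRne, hBne, hColne, -⟩ := counts s hs ha
  obtain ⟨hB', hCol', -, -, hR'ne, hB'ne, hCol'ne, -⟩ := counts t ht ha'
  obtain ⟨hB'', hCol'', -, -, hR''ne, hB''ne, hCol''ne, -⟩ := counts r hr ha''
  have ha0 : ((rSet s).card : ℚ) ≠ 0 := by exact_mod_cast ne_of_gt ha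
  have ha'0 : ((rSet t).card : ℚ) ≠ 0 := by exact_mod_cast ne_of_gt ha'
  have ha''0 : ((rSet r).card : ℚ) ≠ 0 := by exact_mod_cast ne_of_gt ha''
  have hcols := card_colSet' s hs; have hcolt := card_colSet' t ht; have hcolr := card_colSet' r hr
  have hcol0 : ((rSet s).card : ℚ) + (cellSet s).card ≠ 0 := by
    have h : ((colSet s).card : ℚ) ≠ 0 := by exact_mod_cast ne_of_gt (Finset.card_pos.2 hColne)
    rwa [hcols, Nat.cast_add] at h
  have hcol'0 : ((rSet t).card : ℚ) + (cellSet t).card ≠ 0 := by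
    have h : ((colSet t).card : ℚ) ≠ 0 := by exact_mod_cast ne_of_gt (Finset.card_pos.2 hCol'ne)
    rwa [hcolt, Nat.cast_add] at h
  have hcol''0 : ((rSet r).card : ℚ) + (cellSet r).card ≠ 0 := by
    have h : ((colSet r).card : ℚ) ≠ 0 := by exact_mod_cast ne_of_gt (Finset.card_pos.2 hCol''ne)
    rwa [hcolr, Nat.cast_add] at h
  have hE20q := count20q s t r hs ht hr
  have hE11q := count11q s t r hs ht hr
  have hEpos := count20_pos s t r hs ht hr ha ha' ha''
  have hE'pos := count11_pos s t r hs ht hr ha ha' ha''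
  have hE0 : (tailCount (V2Closure.SP.par (V2Closure.SP.par s t) r) 2 0 : ℚ) ≠ 0 := ne_of_gt hEpos
  have hE'0 : (tailCount (V2Closure.SP.par (V2Closure.SP.par s t) r) 1 1 : ℚ) ≠ 0 := ne_of_gt hE'pos
  have hE0p := hE0; rw [hE20q] at hE0p
  have hE'0p := hE'0; rw [hE11q] at hE'0p
  simp only [Fin.sum_univ_succ, Fin.sum_univ_zero, cert20W, cert20A, cert20B, Matrix.cons_val_zero,
      Matrix.cons_val_succ, unifDens_par_prod, unifDens_par_tail, mem_pair_prod, card_pair_prod, rLab_par, bLab_par,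
      mem_rSet, mem_bSet, mem_cellSet, hB, hB', hB'', hcols, hcolt, hcolr, Nat.cast_add, Nat.cast_mul]
  rcases flowOne_cases t ht q.2 with hy | hy | hy <;> rcases flowOne_cases r hr z with hz | hz | hz
  · simp (config := { decide := true }) [hx.1, hx.2, hy.1, hy.2, hz.1, hz.2]
    field_simp
    rw [hE11q]
    ring
  · simp (config := { decide := true }) [hx.1, hx.2, hy.1, hy.2, hz.1, hz.2]
    field_simp
    ring
  · have hcr0 : ((cellSet r).card : ℚ) ≠ 0 := by
      exact_mod_cast ne_of_gt (Finset.card_pos.2 ⟨z, (by rw [mem_cellSet]; exact hz)⟩)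
    simp (config := { decide := true }) [hx.1, hx.2, hy.1, hy.2, hz.1, hz.2]
    field_simp
    ring
  · simp (config := { decide := true }) [hx.1, hx.2, hy.1, hy.2, hz.1, hz.2]
    field_simp
    ring
  · simp (config := { decide := true }) [hx.1, hx.2, hy.1, hy.2, hz.1, hz.2]
  · simp (config := { decide := true }) [hx.1, hx.2, hy.1, hy.2, hz.1, hz.2]
  · have hct0 : ((cellSet t).card : ℚ) ≠ 0 := by
      exact_mod_cast ne_of_gt (Finset.card_pos.2 ⟨q.2, (by rw [mem_cellSet]; exact hy)⟩)
    simp (config := { decide := true }) [hx.1, hx.2, hy.1, hy.2, hz.1, hz.2]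
    field_simp
    ring
  · simp (config := { decide := true }) [hx.1, hx.2, hy.1, hy.2, hz.1, hz.2]
  · simp (config := { decide := true }) [hx.1, hx.2, hy.1, hy.2, hz.1, hz.2]
/-- the coverage identity of the `(2,0)` certificate (source side, first factor in `B`) -/
theorem cov20_src_B (hs : FlowOne s) (ht : FlowOne t) (hr : FlowOne r) (ha : 0 < (rSet s).card)
    (ha' : 0 < (rSet t).card) (ha'' : 0 < (rSet r).card) (q : (V2Closure.SP.par s t).Conf) (z : r.Conf)
    (hx : s.rLab q.1 = 0 ∧ s.bLab q.1 = 1) :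
    ∑ k : Fin 21, cert20W s t r k * unifDens (V2Closure.SP.par (V2Closure.SP.par s t) r) (cert20A s t k ×ˢ cert20B r k) ((q, z) : (V2Closure.SP.par s t).Conf × r.Conf)
      = unifDens (V2Closure.SP.par (V2Closure.SP.par s t) r) (tailSet (V2Closure.SP.par (V2Closure.SP.par s t) r) 2 0) ((q, z) : (V2Closure.SP.par s t).Conf × r.Conf) := by
  obtain ⟨hB, hCol, -, -, hRne, hBne, hColne, -⟩ := counts s hs ha
  obtain ⟨hB', hCol', -, -, hR'ne, hB'ne, hCol'ne, -⟩ := counts t ht ha'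
  obtain ⟨hB'', hCol'', -, -, hR''ne, hB''ne, hCol''ne, -⟩ := counts r hr ha''
  have ha0 : ((rSet s).card : ℚ) ≠ 0 := by exact_mod_cast ne_of_gt ha
  have ha'0 : ((rSet t).card : ℚ) ≠ 0 := by exact_mod_cast ne_of_gt ha'
  have ha''0 : ((rSet r).card : ℚ) ≠ 0 := by exact_mod_cast ne_of_gt ha''
  have hcols := card_colSet' s hs; have hcolt := card_colSet' t ht; have hcolr := card_colSet' r hr
  have hcol0 : ((rSet s).card : ℚ) + (cellSet s).card ≠ 0 := by
    have h : ((colSet s).card : ℚ) ≠ 0 := by exact_mod_cast ne_of_gt (Finset.card_pos.2 hColne)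
    rwa [hcols, Nat.cast_add] at h
  have hcol'0 : ((rSet t).card : ℚ) + (cellSet t).card ≠ 0 := by
    have h : ((colSet t).card : ℚ) ≠ 0 := by exact_mod_cast ne_of_gt (Finset.card_pos.2 hCol'ne)
    rwa [hcolt, Nat.cast_add] at h
  have hcol''0 : ((rSet r).card : ℚ) + (cellSet r).card ≠ 0 := by
    have h : ((colSet r).card : ℚ) ≠ 0 := by exact_mod_cast ne_of_gt (Finset.card_pos.2 hCol''ne)
    rwa [hcolr, Nat.cast_add] at h
  have hE20q := count20q s t r hs ht hr
  have hE11q := count11q s t r hs ht hr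
  have hEpos := count20_pos s t r hs ht hr ha ha' ha''
  have hE'pos := count11_pos s t r hs ht hr ha ha' ha''
  have hE0 : (tailCount (V2Closure.SP.par (V2Closure.SP.par s t) r) 2 0 : ℚ) ≠ 0 := ne_of_gt hEpos
  have hE'0 : (tailCount (V2Closure.SP.par (V2Closure.SP.par s t) r) 1 1 : ℚ) ≠ 0 := ne_of_gt hE'pos
  have hE0p := hE0; rw [hE20q] at hE0p
  have hE'0p := hE'0; rw [hE11q] at hE'0p
  simp only [Fin.sum_univ_succ, Fin.sum_univ_zero, cert20W, cert20A, cert20B, Matrix.cons_val_zero,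
      Matrix.cons_val_succ, unifDens_par_prod, unifDens_par_tail, mem_pair_prod, card_pair_prod, rLab_par, bLab_par,
      mem_rSet, mem_bSet, mem_cellSet, hB, hB', hB'', hcols, hcolt, hcolr, Nat.cast_add, Nat.cast_mul]
  rcases flowOne_cases t ht q.2 with hy | hy | hy <;> rcases flowOne_cases r hr z with hz | hz | hz
  · simp (config := { decide := true }) [hx.1, hx.2, hy.1, hy.2, hz.1, hz.2]
    field_simp
    ring
  · simp (config := { decide := true }) [hx.1, hx.2, hy.1, hy.2, hz.1, hz.2]
  · simp (config := { decide := true }) [hx.1, hx.2, hy.1, hy.2, hz.1, hz.2]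
  · simp (config := { decide := true }) [hx.1, hx.2, hy.1, hy.2, hz.1, hz.2]
  · simp (config := { decide := true }) [hx.1, hx.2, hy.1, hy.2, hz.1, hz.2]
  · simp (config := { decide := true }) [hx.1, hx.2, hy.1, hy.2, hz.1, hz.2]
  · simp (config := { decide := true }) [hx.1, hx.2, hy.1, hy.2, hz.1, hz.2]
  · simp (config := { decide := true }) [hx.1, hx.2, hy.1, hy.2, hz.1, hz.2]
  · simp (config := { decide := true }) [hx.1, hx.2, hy.1, hy.2, hz.1, hz.2]
/-- the coverage identity of the `(2,0)` certificate (source side, first factor in `C`) -/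
theorem cov20_src_C (hs : FlowOne s) (ht : FlowOne t) (hr : FlowOne r) (ha : 0 < (rSet s).card)
    (ha' : 0 < (rSet t).card) (ha'' : 0 < (rSet r).card) (q : (V2Closure.SP.par s t).Conf) (z : r.Conf)
    (hx : s.rLab q.1 = 0 ∧ s.bLab q.1 = 0) :
    ∑ k : Fin 21, cert20W s t r k * unifDens (V2Closure.SP.par (V2Closure.SP.par s t) r) (cert20A s t k ×ˢ cert20B r k) ((q, z) : (V2Closure.SP.par s t).Conf × r.Conf)
      = unifDens (V2Closure.SP.par (V2Closure.SP.par s t) r) (tailSet (V2Closure.SP.par (V2Closure.SP.par s t) r) 2 0) ((q, z) : (V2Closure.SP.par s t).Conf × r.Conf) := by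
  obtain ⟨hB, hCol, -, -, hRne, hBne, hColne, -⟩ := counts s hs ha
  obtain ⟨hB', hCol', -, -, hR'ne, hB'ne, hCol'ne, -⟩ := counts t ht ha'
  obtain ⟨hB'', hCol'', -, -, hR''ne, hB''ne, hCol''ne, -⟩ := counts r hr ha''
  have ha0 : ((rSet s).card : ℚ) ≠ 0 := by exact_mod_cast ne_of_gt ha
  have ha'0 : ((rSet t).card : ℚ) ≠ 0 := by exact_mod_cast ne_of_gt ha'
  have ha''0 : ((rSet r).card : ℚ) ≠ 0 := by exact_mod_cast ne_of_gt ha''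
  have hcols := card_colSet' s hs; have hcolt := card_colSet' t ht; have hcolr := card_colSet' r hr
  have hcol0 : ((rSet s).card : ℚ) + (cellSet s).card ≠ 0 := by
    have h : ((colSet s).card : ℚ) ≠ 0 := by exact_mod_cast ne_of_gt (Finset.card_pos.2 hColne)
    rwa [hcols, Nat.cast_add] at h
  have hcol'0 : ((rSet t).card : ℚ) + (cellSet t).card ≠ 0 := by
    have h : ((colSet t).card : ℚ) ≠ 0 := by exact_mod_cast ne_of_gt (Finset.card_pos.2 hCol'ne)
    rwa [hcolt, Nat.cast_add] at h
  have hcol''0 : ((rSet r).card : ℚ) + (cellSet r).card ≠ 0 := by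
    have h : ((colSet r).card : ℚ) ≠ 0 := by exact_mod_cast ne_of_gt (Finset.card_pos.2 hCol''ne)
    rwa [hcolr, Nat.cast_add] at h
  have hE20q := count20q s t r hs ht hr
  have hE11q := count11q s t r hs ht hr
  have hEpos := count20_pos s t r hs ht hr ha ha' ha''
  have hE'pos := count11_pos s t r hs ht hr ha ha' ha''
  have hE0 : (tailCount (V2Closure.SP.par (V2Closure.SP.par s t) r) 2 0 : ℚ) ≠ 0 := ne_of_gt hEpos
  have hE'0 : (tailCount (V2Closure.SP.par (V2Closure.SP.par s t) r) 1 1 : ℚ) ≠ 0 := ne_of_gt hE'pos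
  have hE0p := hE0; rw [hE20q] at hE0p
  have hE'0p := hE'0; rw [hE11q] at hE'0p
  have hcs0 : ((cellSet s).card : ℚ) ≠ 0 := by
    exact_mod_cast ne_of_gt (Finset.card_pos.2 ⟨q.1, by rw [mem_cellSet]; exact hx⟩)
  simp only [Fin.sum_univ_succ, Fin.sum_univ_zero, cert20W, cert20A, cert20B, Matrix.cons_val_zero,
      Matrix.cons_val_succ, unifDens_par_prod, unifDens_par_tail, mem_pair_prod, card_pair_prod, rLab_par, bLab_par,
      mem_rSet, mem_bSet, mem_cellSet, hB, hB', hB'', hcols, hcolt, hcolr, Nat.cast_add, Nat.cast_mul]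
  rcases flowOne_cases t ht q.2 with hy | hy | hy <;> rcases flowOne_cases r hr z with hz | hz | hz
  · simp (config := { decide := true }) [hx.1, hx.2, hy.1, hy.2, hz.1, hz.2]
    field_simp
    ring
  · simp (config := { decide := true }) [hx.1, hx.2, hy.1, hy.2, hz.1, hz.2]
  · simp (config := { decide := true }) [hx.1, hx.2, hy.1, hy.2, hz.1, hz.2]
  · simp (config := { decide := true }) [hx.1, hx.2, hy.1, hy.2, hz.1, hz.2]
  · simp (config := { decide := true }) [hx.1, hx.2, hy.1, hy.2, hz.1, hz.2]
  · simp (config := { decide := true }) [hx.1, hx.2, hy.1, hy.2, hz.1, hz.2]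
  · simp (config := { decide := true }) [hx.1, hx.2, hy.1, hy.2, hz.1, hz.2]
  · simp (config := { decide := true }) [hx.1, hx.2, hy.1, hy.2, hz.1, hz.2]
  · simp (config := { decide := true }) [hx.1, hx.2, hy.1, hy.2, hz.1, hz.2]
end Twenty

end Summit.Ventures.PercRepro2.Tail2D
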